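import Mathlib
import HarnessLib

/-!
# Double annihilator from a cyclic socle (crux `FRationalResolution`, line `Sketch`, stub G1)

Route `FrobeniusLadder`, crux stmt-ResolutionOfSingularities-15317, by-product programme of the
continuation seat c3: "F-rational Gorenstein local rings are weakly F-regular" (Hochster–Huneke
1994) in the tree's vocabulary. This file proves the DOUBLE ANNIHILATOR property of an
`𝔪`-primary ideal `q` of a Noetherian local ring `(R, 𝔪)` whose socle is cyclic,
`(q : 𝔪) = q + (t)`: every ideal `J ⊇ q` satisfies `q : (q : J) = J` (i.e. `R/q` is a
zero-dimensional Gorenstein ring in the sense of Matsumura, Thm. 18.1 (5') ⇒ (4), here proved by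
counting lengths instead of via injective hulls).

Proof. Write `c(I) = (q : I)` and `L(I) = ℓ_R(R/I)` (finite for `I ⊇ q`). One step: if
`J' = J + (a)` with `𝔪a ⊆ J` then `b ↦ ab` embeds `c(J)/c(J')` into the socle `(q : 𝔪)/q`, a
cyclic module killed by `𝔪`, so `L(c(J')) ≤ L(c(J)) + 1` while `L(J') + 1 ≤ L(J)`; along a chain
of such steps (which exists between any `q ⊆ J ⊆ J'`, `𝔪` being nilpotent on `R/q`) the quantity
`F(J) = L(c(J)) + L(J)` can only decrease: `F(J') ≤ F(J)`. Its values at the two ends `J = q`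
(`c(q) = R`) and `J' = R` (`c(R) = q`) are both `L(q)`, so `F ≡ L(q)` on ideals containing `q`.
Comparing `F(J)` with `F(c(J))` gives `L(c(c(J))) = L(J)`, and `J ⊆ c(c(J))` forces equality.
-/

set_option linter.dupNamespace false

noncomputable section

namespace Summit.ResolutionOfSingularities.ResolutionOfSingularities.Theorems.FRationalResolution

open IsLocalRing

section DoubleColon

variable {R : Type} [CommRing R]

/-- Lengths of nested quotients add up: for submodules `K' ≤ K` of `M`,
`ℓ(M/K') = ℓ(K/K') + ℓ(M/K)`, with `K/K'` realised as the image of `K` in `M/K'`. [folklore] -/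
theorem length_quotient_eq_add_of_le {M : Type} [AddCommGroup M] [Module R M]
    {K' K : Submodule R M} (h : K' ≤ K) :
    Module.length R (M ⧸ K') =
      Module.length R (Submodule.map K'.mkQ K) + Module.length R (M ⧸ K) := by
  have hker : K' ≤ LinearMap.ker K.mkQ := by rw [Submodule.ker_mkQ]; exact h
  refine Module.length_eq_add_of_exact (Submodule.map K'.mkQ K).subtype (K'.liftQ K.mkQ hker)
    (Submodule.subtype_injective _) ?_ ?_
  · intro x
    obtain ⟨m, rfl⟩ := Submodule.mkQ_surjective K x
    exact ⟨K'.mkQ m, by simp⟩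
  · rw [LinearMap.exact_iff, Submodule.range_subtype, Submodule.ker_liftQ, Submodule.ker_mkQ]

/-- Lengths of quotients are antitone in the submodule. [folklore] -/
theorem length_quotient_anti {M : Type} [AddCommGroup M] [Module R M] {J J₁ : Submodule R M}
    (h : J ≤ J₁) : Module.length R (M ⧸ J₁) ≤ Module.length R (M ⧸ J) := by
  rw [Module.length_quotient, Module.length_quotient]
  exact Order.coheight_anti h

/-- Lengths of quotients drop strictly along a strict inclusion: `J < J₁ ⇒ ℓ(M/J₁) + 1 ≤ ℓ(M/J)`.
[folklore] -/
theorem length_quotient_add_one_le {M : Type} [AddCommGroup M] [Module R M]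
    {J J₁ : Submodule R M} (h : J < J₁) :
    Module.length R (M ⧸ J₁) + 1 ≤ Module.length R (M ⧸ J) := by
  rw [Module.length_quotient, Module.length_quotient]
  exact Order.coheight_add_one_le h

/-- Over a Noetherian local ring `(R, 𝔪)`, the quotients `R/J` with `𝔪ⁿ ⊆ J` have finite length
(`𝔪/J` is the only prime of `R/J`, so `R/J` is Artinian). [folklore] -/
theorem length_quotient_ne_top_of_pow_le [IsNoetherianRing R] [IsLocalRing R] {J : Ideal R}
    {n : ℕ} (hJ : maximalIdeal R ^ n ≤ J) : Module.length R (R ⧸ J) ≠ ⊤ := by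
  by_cases hJtop : J = ⊤
  · subst hJtop
    haveI : Subsingleton (R ⧸ (⊤ : Ideal R)) := Ideal.Quotient.subsingleton_iff.mpr rfl
    rw [Module.length_eq_zero]
    exact ENat.zero_ne_top
  rw [Module.length_ne_top_iff, isFiniteLength_iff_isNoetherian_isArtinian]
  refine ⟨inferInstance, ?_⟩
  have hmin : maximalIdeal R ∈ J.minimalPrimes := by
    refine ⟨⟨inferInstance, le_maximalIdeal hJtop⟩, fun p hp _ => ?_⟩
    have hpp : p.IsPrime := hp.1
    intro a ha
    exact hpp.mem_of_pow_mem n ((hJ.trans hp.2) (Ideal.pow_mem_pow ha n))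
  haveI : IsArtinianRing (R ⧸ J) :=
    IsLocalRing.quotient_artinian_of_mem_minimalPrimes_of_isLocalRing J hmin
  exact isArtinian_of_surjective_algebraMap (R := R ⧸ J) (S := R) Ideal.Quotient.mk_surjective

/-- One refinement step: if `𝔪^N ⊆ J < J'` then some `a ∈ J' ∖ J` has `𝔪a ⊆ J` (take the least
`n` with `𝔪ⁿJ' ⊆ J` and `a ∈ 𝔪ⁿ⁻¹J' ∖ J`). [folklore] -/
theorem exists_mem_notMem_maximalIdeal_mul_le (𝔪 : Ideal R) (N : ℕ) {J J' : Ideal R}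
    (hN : 𝔪 ^ N ≤ J) (hJJ' : J < J') :
    ∃ a ∈ J', a ∉ J ∧ ∀ m ∈ 𝔪, m * a ∈ J := by
  classical
  have hex : ∃ n, 𝔪 ^ n * J' ≤ J := ⟨N, Ideal.mul_le_right.trans hN⟩
  have hn : 𝔪 ^ Nat.find hex * J' ≤ J := Nat.find_spec hex
  have hn0 : Nat.find hex ≠ 0 := by
    intro h0
    have h := hn
    rw [h0, pow_zero, Ideal.one_eq_top, Ideal.top_mul] at h
    exact hJJ'.not_ge h
  obtain ⟨k, hk⟩ := Nat.exists_eq_succ_of_ne_zero hn0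
  have hlt : ¬ 𝔪 ^ k * J' ≤ J := Nat.find_min hex (by omega)
  obtain ⟨a, ha, haJ⟩ := SetLike.not_le_iff_exists.mp hlt
  refine ⟨a, Ideal.mul_le_left ha, haJ, fun m hm => hn ?_⟩
  rw [hk, pow_succ', mul_assoc]
  exact Ideal.mul_mem_mul hm ha

/-- A cyclic module killed by a maximal ideal has length `≤ 1`: for `t` with `𝔪 t ⊆ q`, the image
of `(t)` in `R/q` is a quotient of the simple module `R/𝔪`. [folklore] -/
theorem length_map_span_singleton_le_one [IsLocalRing R] (q : Ideal R) (t : R)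
    (ht : ∀ m ∈ maximalIdeal R, m * t ∈ q) :
    Module.length R (Submodule.map q.mkQ (Ideal.span {t})) ≤ 1 := by
  -- the surjection `R/𝔪 ↠ (t̄)`
  have hker : maximalIdeal R ≤
      LinearMap.ker (LinearMap.toSpanSingleton R (R ⧸ q) (q.mkQ t)) := by
    intro m hm
    rw [LinearMap.mem_ker, LinearMap.toSpanSingleton_apply, Submodule.mkQ_apply,
      ← Submodule.Quotient.mk_smul, Submodule.Quotient.mk_eq_zero, smul_eq_mul]
    exact ht m hm
  set g := (maximalIdeal R).liftQ _ hker with hg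
  have hrange : LinearMap.range g = Submodule.map q.mkQ (Ideal.span {t}) := by
    rw [hg, Submodule.range_liftQ, ← LinearMap.span_singleton_eq_range, Submodule.map_span,
      Set.image_singleton, Submodule.mkQ_apply]
  have hsimple : IsSimpleModule R (R ⧸ maximalIdeal R) :=
    isSimpleModule_iff_isCoatom.mpr (Ideal.isMaximal_def.mp (maximalIdeal.isMaximal R))
  calc Module.length R (Submodule.map q.mkQ (Ideal.span {t}))
      = Module.length R (LinearMap.range g) := by rw [hrange]
    _ ≤ Module.length R (R ⧸ maximalIdeal R) :=
        Module.length_le_of_surjective g.rangeRestrict g.surjective_rangeRestrict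
    _ = 1 := Module.length_eq_one R _

/-- The one-step colon bound: if `(q : 𝔪) = q + (t)` and `𝔪a ⊆ J`, then
`ℓ(R/(q : (J + (a)))) ≤ ℓ(R/(q : J)) + 1` — multiplication by `a` embeds `(q : J)/(q : (J + (a)))`
into the cyclic socle `(q : 𝔪)/q`. [folklore; Matsumura1987 Thm. 18.1, proof technique] -/
theorem length_quotient_colon_sup_span_le [IsLocalRing R] (q J : Ideal R) (t a : R)
    (hsoc : q.colon (maximalIdeal R : Set R) = q ⊔ Ideal.span {t})
    (ha : ∀ m ∈ maximalIdeal R, m * a ∈ J) :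
    Module.length R (R ⧸ q.colon ((J ⊔ Ideal.span {a} : Ideal R) : Set R)) ≤
      Module.length R (R ⧸ q.colon (J : Set R)) + 1 := by
  set K : Ideal R := q.colon (J : Set R) with hK
  set K' : Ideal R := q.colon ((J ⊔ Ideal.span {a} : Ideal R) : Set R) with hK'
  -- `K' = K ∩ (q : a)`
  have hK'eq : K' = K ⊓ q.colon {a} := by
    have hsup : (J ⊔ Ideal.span {a} : Ideal R) = Ideal.span ((J : Set R) ∪ {a}) := by
      rw [Ideal.span_union, Ideal.span_eq]
    rw [hK', hsup, Ideal.colon_span, Submodule.colon_union]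
  have hK'K : K' ≤ K := hK'eq ▸ inf_le_left
  -- socle facts
  have ht : ∀ m ∈ maximalIdeal R, m * t ∈ q := fun m hm => by
    have htmem : t ∈ q.colon (maximalIdeal R : Set R) := by
      rw [hsoc]; exact Ideal.mem_sup_right (Ideal.mem_span_singleton_self t)
    rw [mul_comm]
    exact Submodule.mem_colon.mp htmem m hm
  -- multiplication by `a`: `R/K' → R/q`
  have hle : K' ≤ LinearMap.ker (q.mkQ ∘ₗ LinearMap.mulLeft R a) := by
    intro b hb
    rw [LinearMap.mem_ker, LinearMap.comp_apply, LinearMap.mulLeft_apply, Submodule.mkQ_apply,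
      Submodule.Quotient.mk_eq_zero, mul_comm]
    have hb' : b ∈ q.colon {a} := (hK'eq ▸ hb : b ∈ K ⊓ q.colon {a}).2
    simpa [Submodule.mem_colon_singleton, smul_eq_mul] using hb'
  set φ : (R ⧸ K') →ₗ[R] (R ⧸ q) := K'.liftQ _ hle with hφ
  have hφapply : ∀ b : R, φ (K'.mkQ b) = q.mkQ (a * b) := fun b => rfl
  -- restricted to `K/K'` it is injective with image in the socle `((t) + q)/q`
  set P : Submodule R (R ⧸ K') := Submodule.map K'.mkQ K with hP
  have hmemT : ∀ x : P, φ x ∈ Submodule.map q.mkQ (Ideal.span {t}) := by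
    rintro ⟨x, hx⟩
    obtain ⟨b, hb, rfl⟩ := Submodule.mem_map.mp hx
    have hab : a * b ∈ q.colon (maximalIdeal R : Set R) := by
      refine Submodule.mem_colon.mpr fun m hm => ?_
      have h := Submodule.mem_colon.mp hb (m * a) (ha m hm)
      rw [smul_eq_mul] at h ⊢
      rw [show a * b * m = b * (m * a) by ring]
      exact h
    have himg : q.mkQ (a * b) ∈ Submodule.map q.mkQ (q.colon (maximalIdeal R : Set R)) :=
      Submodule.mem_map_of_mem hab
    rw [hsoc, Submodule.map_sup, Submodule.mkQ_map_self, bot_sup_eq] at himg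
    change φ (K'.mkQ b) ∈ _
    rw [hφapply]
    exact himg
  set ψ : P →ₗ[R] Submodule.map q.mkQ (Ideal.span {t}) :=
    LinearMap.codRestrict _ (φ ∘ₗ P.subtype) hmemT with hψ
  have hψinj : Function.Injective ψ := by
    rw [← LinearMap.ker_eq_bot, LinearMap.ker_codRestrict, Submodule.eq_bot_iff]
    rintro ⟨x, hx⟩ hx0
    obtain ⟨b, hb, rfl⟩ := Submodule.mem_map.mp hx
    rw [LinearMap.mem_ker, LinearMap.comp_apply, Submodule.subtype_apply] at hx0
    change φ (K'.mkQ b) = 0 at hx0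
    rw [hφapply] at hx0
    have hab : a * b ∈ q := (Submodule.Quotient.mk_eq_zero q).mp hx0
    have hbK' : b ∈ K' := by
      rw [hK'eq]
      refine Submodule.mem_inf.mpr ⟨hb, Submodule.mem_colon_singleton.mpr ?_⟩
      rw [smul_eq_mul, mul_comm]
      exact hab
    refine Subtype.ext ?_
    exact (Submodule.Quotient.mk_eq_zero K').mpr hbK'
  -- count
  rw [length_quotient_eq_add_of_le hK'K, add_comm]
  gcongr
  calc Module.length R P ≤ Module.length R (Submodule.map q.mkQ (Ideal.span {t})) :=
        Module.length_le_of_injective ψ hψinj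
    _ ≤ 1 := length_map_span_singleton_le_one q t ht

/-- **STUB G1 — DOUBLE ANNIHILATOR FROM A CYCLIC SOCLE.** `(R, 𝔪)` Noetherian local, `q` an
`𝔪`-primary ideal (`𝔪^N ⊆ q`) whose socle is cyclic, `(q : 𝔪) = q + (t)`. Then every ideal
`J ⊇ q` satisfies `q : (q : J) = J` (`R/q` is zero-dimensional Gorenstein). Proof by counting:
`F(J) = ℓ(R/(q:J)) + ℓ(R/J)` decreases along refinement chains (one-step bound
`length_quotient_colon_sup_span_le`), takes the value `ℓ(R/q)` at both ends `J = q` and `J = R`,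
hence is constant; compare `F(J)` with `F(q:J)` and use `J ⊆ q : (q : J)`.
[Matsumura1987 Thm. 18.1 (5') ⇒ (4); BrunsHerzog1998 3.2.15 — here by a length count] -/
theorem stub_doubleColon_of_socle_cyclic (R : Type) [CommRing R] [IsNoetherianRing R] [IsLocalRing R]
    (q : Ideal R) (N : ℕ) (hN : IsLocalRing.maximalIdeal R ^ N ≤ q) (t : R)
    (hsoc : q.colon (IsLocalRing.maximalIdeal R : Set R) = q ⊔ Ideal.span {t})
    (J : Ideal R) (hJ : q ≤ J) :
    q.colon ((q.colon (J : Set R) : Ideal R) : Set R) = J := by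
  -- notation: `c I = (q : I)`, `L I = ℓ(R/I)`
  set c : Ideal R → Ideal R := fun I => q.colon (I : Set R) with hc
  set L : Ideal R → ℕ∞ := fun I => Module.length R (R ⧸ I) with hL
  have hfinI : ∀ I : Ideal R, q ≤ I → L I ≠ ⊤ := fun I hI =>
    ne_top_of_le_ne_top (length_quotient_ne_top_of_pow_le hN) (length_quotient_anti hI)
  have hq_le_c : ∀ I : Ideal R, q ≤ c I := fun I => Ideal.le_colon
  have hc_top : c ⊤ = q := by
    simp only [hc, Submodule.top_coe]
    exact Submodule.colon_univ
  have hc_q : c q = ⊤ := (Submodule.colon_eq_top_iff_subset _).mpr subset_rfl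
  have hle_cc : ∀ I : Ideal R, I ≤ c (c I) := fun I x hx =>
    Submodule.mem_colon.mpr fun s hs => by
      rw [smul_eq_mul, mul_comm]
      exact Submodule.mem_colon.mp hs x hx
  have hLtop : L ⊤ = 0 := by
    haveI : Subsingleton (R ⧸ (⊤ : Ideal R)) := Ideal.Quotient.subsingleton_iff.mpr rfl
    exact Module.length_eq_zero
  -- the chain inequality `F(I') ≤ F(I)` for `q ≤ I ≤ I'`, by induction on `ℓ(R/I)`
  have hchain : ∀ k : ℕ, ∀ I I' : Ideal R, q ≤ I → I ≤ I' → L I ≤ k →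
      L (c I') + L I' ≤ L (c I) + L I := by
    intro k
    induction k with
    | zero =>
      intro I I' _ hII' hk
      have hI : I = ⊤ := by
        have h0 : L I = 0 := nonpos_iff_eq_zero.mp (by exact_mod_cast hk)
        exact Ideal.Quotient.subsingleton_iff.mp (Module.length_eq_zero_iff.mp h0)
      have hI' : I' = ⊤ := top_le_iff.mp (hI ▸ hII')
      rw [hI, hI']
    | succ k ih =>
      intro I I' hqI hII' hk
      rcases eq_or_lt_of_le hII' with rfl | hlt
      · exact le_rfl
      obtain ⟨a, haI', haI, hma⟩ :=
        exists_mem_notMem_maximalIdeal_mul_le (maximalIdeal R) N (hN.trans hqI) hlt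
      have hI₁ : I < I ⊔ Ideal.span {a} := lt_of_le_of_ne le_sup_left fun h =>
        haI (h ▸ Ideal.mem_sup_right (Ideal.mem_span_singleton_self a))
      have hI₁I' : I ⊔ Ideal.span {a} ≤ I' :=
        sup_le hII' ((Ideal.span_singleton_le_iff_mem _).mpr haI')
      have h1 : L (I ⊔ Ideal.span {a}) + 1 ≤ L I := length_quotient_add_one_le hI₁
      have hk' : L (I ⊔ Ideal.span {a}) ≤ k := by
        have h2 : L (I ⊔ Ideal.span {a}) + 1 ≤ (k : ℕ∞) + 1 := by
          refine h1.trans ?_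
          exact_mod_cast hk
        exact (ENat.add_le_add_iff_right ENat.one_ne_top).mp h2
      have hstep : L (c (I ⊔ Ideal.span {a})) ≤ L (c I) + 1 :=
        length_quotient_colon_sup_span_le q I t a hsoc hma
      calc L (c I') + L I'
          ≤ L (c (I ⊔ Ideal.span {a})) + L (I ⊔ Ideal.span {a}) :=
            ih _ I' (hqI.trans hI₁.le) hI₁I' hk'
        _ ≤ (L (c I) + 1) + L (I ⊔ Ideal.span {a}) := by gcongr
        _ = L (c I) + (L (I ⊔ Ideal.span {a}) + 1) := by
            rw [add_assoc, add_comm 1]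
        _ ≤ L (c I) + L I := by gcongr
  -- `F ≡ ℓ(R/q)` on ideals containing `q`
  have hF : ∀ I : Ideal R, q ≤ I → L (c I) + L I = L q := by
    intro I hqI
    obtain ⟨kq, hkq⟩ := WithTop.ne_top_iff_exists.mp (hfinI q le_rfl)
    obtain ⟨kI, hkI⟩ := WithTop.ne_top_iff_exists.mp (hfinI I hqI)
    apply le_antisymm
    · have h := hchain kq q I le_rfl hqI hkq.ge
      rwa [hc_q, hLtop, zero_add] at h
    · have h := hchain kI I ⊤ hqI le_top hkI.ge
      rwa [hc_top, hLtop, add_zero] at h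
  -- compare `F(J)` and `F(q : J)`
  have h1 := hF J hJ
  have h2 := hF (c J) (hq_le_c J)
  have hLK : L (c J) ≠ ⊤ := hfinI (c J) (hq_le_c J)
  have h3 : L (c (c J)) = L J := by
    have h : L (c (c J)) + L (c J) = L J + L (c J) := by rw [h2, ← h1, add_comm]
    exact (WithTop.add_right_inj hLK).mp h
  by_contra hne
  have hlt : J < c (c J) := lt_of_le_of_ne (hle_cc J) (Ne.symm hne)
  have h4 := length_quotient_add_one_le hlt
  change L (c (c J)) + 1 ≤ L J at h4
  rw [h3] at h4
  obtain ⟨n, hn⟩ := WithTop.ne_top_iff_exists.mp (hfinI J hJ)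
  rw [← hn] at h4
  have h5 : (n : ℕ∞) + 1 ≤ n := h4
  exact absurd (by exact_mod_cast h5 : n + 1 ≤ n) (Nat.not_succ_le_self n)

end DoubleColon

end Summit.ResolutionOfSingularities.ResolutionOfSingularities.Theorems.FRationalResolution

end
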